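/-
Copyright (c) 2026. All rights reserved.
Released under Apache 2.0 license as described in the file LICENSE.
Authors: abc-iut cell, campaign-S prover seat abc-iut-S1 (wave 1, gen 7).
-/
import Literature.IUT.LogVolume.UnitLogWildDyadicOcticGaussian
import HarnessLib

/-!
# `ℚ₂(ζ₁₆)`: a dyadic `(e, f) = (8, 1)` field containing `√−1` in which NO unit has a unit `2`-adic logarithm

Proof-only sequel (theorems, no definitions) of `UnitLogWildDyadicQuarticGaussian.lean` (abc-iut-S1:
`(e, f) = (4, 1)`, `√−1 ∈ K` ⇒ `log₂(𝒪_K^×)` misses `𝒪_K^×`) and `UnitLogWildDyadicOcticGaussian.lean`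
(`ℚ₂(⁸√−25)`: `(e, f) = (8, 1)`, `∋ √−1`, meets).  Here the EMPTY side at `(8, 1)` with `√−1`:

* `logUnits_inter_sphere_eq_empty_of_eight_of_pow_eight_eq_neg_one` — **`e(K/ℚ₂) = 8`, `f(K/ℚ₂) = 1`,
  `ξ⁸ = −1` in `K` (a primitive `16`-th root of unity; then `√−1 = ξ⁴ ∈ K`) ⇒ `log₂(𝒪_K^×) ∩ 𝒪_K^× = ∅`.**
  PROOF: `‖1 − ξ‖ = ‖ϖ‖` (`(ξ − 1)⁸ = 70ξ⁴ + 4·P(ξ)` has norm `‖2‖`), so every unit `w` is `≡ 1` or `≡ ξ`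
  `(mod 𝔪²)` (`f = 1`): twisting by `ξ` (which changes `ζ·w⁴` by the root of unity `ξ⁴`) reduces the
  torsion–power equation `‖1 − ζ·w⁴‖ = ‖4‖` (abc-iut-w5-d064) to units `v ≡ 1 (mod 𝔪²)`; there
  `‖1 − v⁴‖ = ‖ϖ‖^{4t}` for `‖1 − v‖ = ‖ϖ‖^t`, `t = 2, 3`, and `≤ ‖ϖ‖¹⁷` for `t ≥ 4`, so `‖1 − ζ‖ ∈
  {‖ϖ‖¹², ‖ϖ‖¹⁶}` forces `ζ = 1` (absurd) and `‖1 − ζ‖ = ‖ϖ‖⁸ = ‖2‖` forces `ζ = −1`, where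
  `1 + v⁴ = (z² + 3)² − 7 + 4z(1 + z²)` runs into the Artin–Schreier obstruction `(ξ⁴y)² ≠ 1 − 4η` of the
  quartic file.
* `exists_cyclotomic_octic_logUnits_inter_sphere_eq_empty` — **`ℚ₂(ζ₁₆) ⊆ ℚ̄₂`: `(e, f) = (8, 1)`, `∋ √−1`,
  EMPTY**; with `ℚ₂(⁸√−25)` (octic file): `exists_octic_gaussian_pair` — **at `(e, f) = (8, 1)` the census
  bit is NOT a function of `(e, f)` even among fields containing `√−1`** (at `(4, 1)` it is: empty).

Classical (Neukirch II (5.5), Koblitz IV §1–2, Washington *Cyclotomic Fields* §1); consumer: the cell's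
(Ind3) honest-model census ([IUTchIII] Rmk. 1.1.1 (i), record only) for the fields of [IUTchI] Def. 3.1.
Nothing here is disputed mathematics; no IUT statement is asserted; nothing bears on [IUTchIII] Cor. 3.12.
-/

noncomputable section

open Metric Set

namespace Literature.IUT.LogVolume

namespace WildDyadicQuartic

open Literature.NumberTheory.GaloisRepresentations.Ultrametric RamificationCriterion

variable {K : Type*} [NontriviallyNormedField K] [instK : NormedAlgebra ℚ_[2] K] [IsUltrametricDist K]
  [ProperSpace K]

omit instK [ProperSpace K] in
/-- Ultrametric bookkeeping: `‖a‖, ‖b‖ ≤ C ⇒ ‖a + b‖ ≤ C`. [folklore] -/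
private theorem ult_add_le {a b : K} {C : ℝ} (ha : ‖a‖ ≤ C) (hb : ‖b‖ ≤ C) : ‖a + b‖ ≤ C :=
  (IsUltrametricDist.norm_add_le_max a b).trans (max_le ha hb)

omit [IsUltrametricDist K] [ProperSpace K] in
/-- Odd natural numbers have norm `1`. [cite: NeukirchANT1999, Ch. II (5.5)] -/
private theorem norm_natCast_odd' {n : ℕ} (hn : n % 2 = 1) : ‖(n : K)‖ = 1 :=
  norm_natCast_eq_one_of_not_dvd 2 (by omega)

omit [IsUltrametricDist K] [ProperSpace K] in
/-- Natural numbers have norm `≤ 1`. [cite: NeukirchANT1999, Ch. II (5.5)] -/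
private theorem norm_natCast_le_one'' (n : ℕ) : ‖(n : K)‖ ≤ 1 := by
  rw [norm_natCast_eq_padicNorm 2 K n]
  exact_mod_cast Padic.norm_int_le_one (n : ℤ)

/-! ### §1. `ξ⁸ = −1 ⇒ ‖(ξ − 1)⁸‖ = ‖2‖`: a primitive `16`-th root of unity sits at level `1` when `e = 8` -/

omit [ProperSpace K] in
/-- **`ξ⁸ = −1 ⇒ ‖(ξ − 1)⁸‖ = 1/2`**: `(ξ − 1)⁸ = 70ξ⁴ + 4·(−2ξ⁷ + 7ξ⁶ − 14ξ⁵ − 14ξ³ + 7ξ² − 2ξ)`, the first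
term of norm `‖2‖`, the second of norm `≤ ‖4‖`. [cite: NeukirchANT1999, Ch. II (5.5)] -/
theorem norm_pow_eight_sub_one_of_pow_eight_eq_neg_one {ξ : K} (hξ : ξ ^ 8 = -1) : ‖(ξ - 1) ^ 8‖ = 2⁻¹ := by
  have hξ1 : ‖ξ‖ = 1 := by
    have h1 : ‖ξ‖ ^ 8 = 1 := by rw [← norm_pow, hξ, norm_neg, norm_one]
    exact (pow_eq_one_iff_of_nonneg (norm_nonneg ξ) (by norm_num)).mp h1
  have hid : (ξ - 1) ^ 8 = 70 * ξ ^ 4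
      + 4 * (-2 * ξ ^ 7 + 7 * ξ ^ 6 + -14 * ξ ^ 5 + -14 * ξ ^ 3 + 7 * ξ ^ 2 + -2 * ξ) := by
    have hexp : (ξ - 1) ^ 8 = ξ ^ 8 - 8 * ξ ^ 7 + 28 * ξ ^ 6 - 56 * ξ ^ 5 + 70 * ξ ^ 4 - 56 * ξ ^ 3
        + 28 * ξ ^ 2 - 8 * ξ + 1 := by ring
    rw [hexp, hξ]
    ring
  have hmain : ‖(70 : K) * ξ ^ 4‖ = 2⁻¹ := by
    rw [norm_mul, show (70 : K) = 2 * 35 by norm_num, norm_mul, WildDyadic.norm_two,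
      show (35 : K) = ((35 : ℕ) : K) by norm_cast, norm_natCast_odd' (by norm_num), norm_pow, hξ1]
    norm_num
  have hmono : ∀ (c k : ℕ), ‖(c : K) * ξ ^ k‖ ≤ 1 := fun c k ↦ by
    rw [norm_mul, norm_pow, hξ1, one_pow, mul_one]; exact norm_natCast_le_one'' c
  have hmono' : ∀ (c k : ℕ), ‖-(c : K) * ξ ^ k‖ ≤ 1 := fun c k ↦ by
    rw [neg_mul, norm_neg]; exact hmono c k
  have hpoly : ‖(-2 : K) * ξ ^ 7 + 7 * ξ ^ 6 + -14 * ξ ^ 5 + -14 * ξ ^ 3 + 7 * ξ ^ 2 + -2 * ξ‖ ≤ 1 := by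
    refine ult_add_le (ult_add_le (ult_add_le (ult_add_le (ult_add_le ?_ ?_) ?_) ?_) ?_) ?_
    · exact_mod_cast hmono' 2 7
    · exact_mod_cast hmono 7 6
    · exact_mod_cast hmono' 14 5
    · exact_mod_cast hmono' 14 3
    · exact_mod_cast hmono 7 2
    · have := hmono' 2 1
      rw [pow_one] at this
      exact_mod_cast this
  have htail : ‖(4 : K) * (-2 * ξ ^ 7 + 7 * ξ ^ 6 + -14 * ξ ^ 5 + -14 * ξ ^ 3 + 7 * ξ ^ 2 + -2 * ξ)‖ ≤ 4⁻¹ := by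
    rw [norm_mul, UnramifiedDyadic.norm_four]
    calc (4⁻¹ : ℝ) * _ ≤ 4⁻¹ * 1 := by gcongr
      _ = 4⁻¹ := mul_one _
  rw [hid]
  have hlt : ‖(4 : K) * (-2 * ξ ^ 7 + 7 * ξ ^ 6 + -14 * ξ ^ 5 + -14 * ξ ^ 3 + 7 * ξ ^ 2 + -2 * ξ)‖
      < ‖(70 : K) * ξ ^ 4‖ := by
    rw [hmain]; exact htail.trans_lt (by norm_num)
  rw [IsUltrametricDist.norm_add_eq_max_of_norm_ne_norm (ne_of_gt hlt), max_eq_left hlt.le, hmain]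

/-- **At `e = 8`: `ξ⁸ = −1 ⇒ ‖1 − ξ‖ = ‖ϖ‖`** (both have eighth power `‖2‖ = 1/2`).
[cite: NeukirchANT1999, Ch. II (5.5)] -/
theorem norm_one_sub_eq_unif_of_pow_eight_eq_neg_one {ϖ : Kˣ} (hϖ : IsUniformizer ϖ)
    (he : absRamificationIdx 2 K = 8) {ξ : K} (hξ : ξ ^ 8 = -1) : ‖1 - ξ‖ = ‖(ϖ : K)‖ := by
  have hρ8 : ‖(ϖ : K)‖ ^ 8 = 2⁻¹ := by
    have := norm_prime_eq_norm_pow 2 K hϖ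
    rw [he] at this
    rw [← WildDyadic.norm_two (K := K)]
    exact_mod_cast this.symm
  have h : ‖1 - ξ‖ ^ 8 = ‖(ϖ : K)‖ ^ 8 := by
    rw [norm_sub_rev, ← norm_pow, norm_pow_eight_sub_one_of_pow_eight_eq_neg_one hξ, hρ8]
  exact (pow_left_inj₀ (norm_nonneg _) (norm_nonneg _) (by norm_num)).mp h

/-! ### §2. Fourth powers of principal units at `e = 8` -/

/-- **`‖v − 1‖ = ‖ϖ‖^t`, `1 ≤ t ≤ 3` ⇒ `‖v⁴ − 1‖ = ‖ϖ‖^{4t}`** at `e = 8` (`z⁴` dominates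
`4z + 6z² + 4z³`). [cite: NeukirchANT1999, Ch. II (5.5)] -/
theorem norm_pow_four_sub_one_eq_of_eight {ϖ : Kˣ} (hϖ : IsUniformizer ϖ) (he : absRamificationIdx 2 K = 8)
    {v : K} {t : ℕ} (ht1 : 1 ≤ t) (ht3 : t ≤ 3) (hv : ‖v - 1‖ = ‖(ϖ : K)‖ ^ t) :
    ‖v ^ 4 - 1‖ = ‖(ϖ : K)‖ ^ (4 * t) := by
  have hρ0 : 0 < ‖(ϖ : K)‖ := norm_units_pos ϖ
  have hρ1 : ‖(ϖ : K)‖ < 1 := hϖ.1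
  have h2 : ‖(2 : K)‖ = ‖(ϖ : K)‖ ^ 8 := by
    have := norm_prime_eq_norm_pow 2 K hϖ
    rw [he] at this; exact_mod_cast this
  have h4 : ‖(4 : K)‖ = ‖(ϖ : K)‖ ^ 16 := by
    rw [show (4 : K) = 2 * 2 by norm_num, norm_mul, h2, ← pow_add]
  have h6 : ‖(6 : K)‖ = ‖(ϖ : K)‖ ^ 8 := by
    rw [show (6 : K) = 2 * 3 by norm_num, norm_mul, h2,
      show (3 : K) = ((3 : ℕ) : K) by norm_cast, norm_natCast_eq_one_of_not_dvd 2 (by norm_num), mul_one]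
  set z : K := v - 1 with hz
  have hz4 : ‖z ^ 4‖ = ‖(ϖ : K)‖ ^ (4 * t) := by rw [norm_pow, hv, ← pow_mul, mul_comm]
  have hle : ∀ {m : ℕ}, 4 * t + 1 ≤ m → ‖(ϖ : K)‖ ^ m ≤ ‖(ϖ : K)‖ ^ (4 * t + 1) := fun hm ↦
    pow_le_pow_of_le_one hρ0.le hρ1.le hm
  have hrest : ‖4 * z + 6 * z ^ 2 + 4 * z ^ 3‖ < ‖(ϖ : K)‖ ^ (4 * t) := by
    have hlt : ‖(ϖ : K)‖ ^ (4 * t + 1) < ‖(ϖ : K)‖ ^ (4 * t) :=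
      pow_lt_pow_right_of_lt_one₀ hρ0 hρ1 (by omega)
    refine lt_of_le_of_lt (ult_add_le (ult_add_le ?_ ?_) ?_) hlt
    · rw [norm_mul, h4, hv, ← pow_add]; exact hle (by omega)
    · rw [norm_mul, h6, norm_pow, hv, ← pow_mul, ← pow_add]; exact hle (by omega)
    · rw [norm_mul, h4, norm_pow, hv, ← pow_mul, ← pow_add]; exact hle (by omega)
  have hsplit : v ^ 4 - 1 = z ^ 4 + (4 * z + 6 * z ^ 2 + 4 * z ^ 3) := by rw [hz]; ring
  rw [hsplit, IsUltrametricDist.norm_add_eq_max_of_norm_ne_norm (by rw [hz4]; exact ne_of_gt hrest), hz4,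
    max_eq_left hrest.le]

/-- **`‖v − 1‖ ≤ ‖ϖ‖⁴ ⇒ ‖v⁴ − 1‖ ≤ ‖ϖ‖¹⁷ (< ‖4‖)`** at `e = 8`, units principal (`v⁴ − 1 = A(A + 2)`,
`A = v² − 1 ∈ 2𝒪`, `A/2 ≡ 1` when a unit). [cite: NeukirchANT1999, Ch. II (5.5)] -/
theorem norm_pow_four_sub_one_le_of_eight {ϖ : Kˣ} (hϖ : IsUniformizer ϖ) (he : absRamificationIdx 2 K = 8)
    (hprinc : ∀ u : K, ‖u‖ = 1 → IsPrincipal u) {v : K} (hv : ‖v - 1‖ ≤ ‖(ϖ : K)‖ ^ 4) :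
    ‖v ^ 4 - 1‖ ≤ ‖(ϖ : K)‖ ^ 17 := by
  have hρ0 : 0 < ‖(ϖ : K)‖ := norm_units_pos ϖ
  have hρ1 : ‖(ϖ : K)‖ < 1 := hϖ.1
  have h2 : ‖(2 : K)‖ = ‖(ϖ : K)‖ ^ 8 := by
    have := norm_prime_eq_norm_pow 2 K hϖ
    rw [he] at this; exact_mod_cast this
  have h20 : (2 : K) ≠ 0 := norm_pos_iff.mp (by rw [h2]; positivity)
  set A : K := v ^ 2 - 1 with hA
  have hA8 : ‖A‖ ≤ ‖(ϖ : K)‖ ^ 8 := by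
    have h28 : ‖(2 : K)‖ ≤ ‖(ϖ : K)‖ ^ 4 := by
      rw [h2]; exact pow_le_pow_of_le_one hρ0.le hρ1.le (by norm_num)
    rw [hA, show v ^ 2 - 1 = (v - 1) * ((v - 1) + 2) by ring, norm_mul, show (8 : ℕ) = 4 + 4 by rfl,
      pow_add]
    exact mul_le_mul hv (ult_add_le hv h28) (norm_nonneg _) (pow_nonneg hρ0.le 4)
  have hfac : v ^ 4 - 1 = A * (A + 2) := by rw [hA]; ring
  rw [hfac, norm_mul, show (17 : ℕ) = 8 + 9 by rfl, pow_add]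
  rcases hA8.lt_or_eq with hlt | heq
  · have hA9 : ‖A‖ ≤ ‖(ϖ : K)‖ ^ 9 := by
      have := norm_le_zpow_succ_of_norm_lt_zpow hϖ (k := 8) (by exact_mod_cast hlt)
      exact_mod_cast this
    have hA2 : ‖A + 2‖ ≤ ‖(ϖ : K)‖ ^ 8 := ult_add_le hA8 (by rw [h2])
    calc ‖A‖ * ‖A + 2‖ ≤ ‖(ϖ : K)‖ ^ 9 * ‖(ϖ : K)‖ ^ 8 :=
          mul_le_mul hA9 hA2 (norm_nonneg _) (pow_nonneg hρ0.le 9)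
      _ = ‖(ϖ : K)‖ ^ 8 * ‖(ϖ : K)‖ ^ 9 := mul_comm _ _
  · have hc : ‖A / 2‖ = 1 := by rw [norm_div, heq, h2, div_self (pow_pos hρ0 8).ne']
    have hcP' : ‖1 - A / 2‖ ≤ ‖(ϖ : K)‖ := by
      have := norm_le_zpow_succ_of_norm_lt_zpow hϖ (k := 0) (by rw [zpow_zero]; exact hprinc _ hc)
      rwa [zero_add, zpow_one] at this
    have hA2 : ‖A + 2‖ ≤ ‖(ϖ : K)‖ ^ 9 := by
      rw [show A + 2 = 2 * (2 + -(1 - A / 2)) by field_simp; ring, norm_mul, h2, pow_succ]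
      refine mul_le_mul le_rfl (ult_add_le ?_ (by rw [norm_neg]; exact hcP')) (norm_nonneg _)
        (pow_nonneg hρ0.le 8)
      rw [h2]
      exact pow_le_of_le_one hρ0.le hρ1.le (by norm_num)
    exact mul_le_mul hA8 hA2 (norm_nonneg _) (pow_nonneg hρ0.le 8)

/-! ### §3. `e = 8`, `f = 1`, `ξ⁸ = −1 ∈ K`: no `ζ·w⁴` on the sphere `‖1 − w‖ = ‖4‖` -/

/-- The torsion–power equation for units `v ≡ 1 (mod 𝔪²)`: `e = 8`, units principal, `i² = −1` ⇒
`‖1 − ζ·v⁴‖ ≠ 1/4` for every root of unity `ζ` and every `v` with `‖v − 1‖ ≤ ‖ϖ‖²`.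
[cite: Koblitz1984, Ch. IV §2] -/
theorem norm_one_sub_torsion_mul_pow_four_ne_of_eight {ϖ : Kˣ} (hϖ : IsUniformizer ϖ)
    (he : absRamificationIdx 2 K = 8) (hprinc : ∀ u : K, ‖u‖ = 1 → IsPrincipal u) {i : K} (hi : i ^ 2 = -1)
    {ζ v : K} (hζ : IsTorsionUnit K ζ) (hv : ‖v - 1‖ ≤ ‖(ϖ : K)‖ ^ 2) : ‖1 - ζ * v ^ 4‖ ≠ (4 : ℝ)⁻¹ := by
  classical
  intro h4
  have hρ0 : 0 < ‖(ϖ : K)‖ := norm_units_pos ϖ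
  have hρ1 : ‖(ϖ : K)‖ < 1 := hϖ.1
  have h2 : ‖(2 : K)‖ = ‖(ϖ : K)‖ ^ 8 := by
    have := norm_prime_eq_norm_pow 2 K hϖ
    rw [he] at this; exact_mod_cast this
  have hρ8 : ‖(ϖ : K)‖ ^ 8 = 2⁻¹ := by rw [← h2]; exact WildDyadic.norm_two
  have hρ16 : ‖(ϖ : K)‖ ^ 16 = 4⁻¹ := by
    rw [show (16 : ℕ) = 8 + 8 by rfl, pow_add, hρ8]; norm_num
  have hζ1 : ‖ζ‖ = 1 := hζ.norm_eq_one
  have hdecomp : 1 - ζ = (1 - ζ * v ^ 4) + ζ * (v ^ 4 - 1) := by ring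
  -- helper: if `‖ζ(v⁴ − 1)‖ < ‖4‖` then `ζ = 1`, absurd
  have hsmall_case : ‖v ^ 4 - 1‖ < ‖(ϖ : K)‖ ^ 16 → False := fun hs ↦ by
    have hs' : ‖ζ * (v ^ 4 - 1)‖ < ‖1 - ζ * v ^ 4‖ := by
      rw [norm_mul, hζ1, one_mul, h4, ← hρ16]; exact hs
    have hζn : ‖1 - ζ‖ = 4⁻¹ := by
      rw [hdecomp, IsUltrametricDist.norm_add_eq_max_of_norm_ne_norm (ne_of_gt hs'), max_eq_left hs'.le, h4]
    have hζ' : ζ = 1 := torsion_eq_one_of_norm_one_sub_lt hζ (by rw [hζn]; norm_num)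
    rw [hζ', sub_self, norm_zero] at hζn
    norm_num at hζn
  rcases hv.lt_or_eq with hlt2 | heq2
  · -- `‖v − 1‖ ≤ ‖ϖ‖³`
    have hv3 : ‖v - 1‖ ≤ ‖(ϖ : K)‖ ^ 3 := by
      have := norm_le_zpow_succ_of_norm_lt_zpow hϖ (k := 2) (z := v - 1) (by exact_mod_cast hlt2)
      exact_mod_cast this
    rcases hv3.lt_or_eq with hlt3 | heq3
    · -- `‖v − 1‖ ≤ ‖ϖ‖⁴`: `‖v⁴ − 1‖ ≤ ‖ϖ‖¹⁷ < ‖4‖`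
      have hv4 : ‖v - 1‖ ≤ ‖(ϖ : K)‖ ^ 4 := by
        have := norm_le_zpow_succ_of_norm_lt_zpow hϖ (k := 3) (z := v - 1) (by exact_mod_cast hlt3)
        exact_mod_cast this
      exact hsmall_case ((norm_pow_four_sub_one_le_of_eight hϖ he hprinc hv4).trans_lt
        (pow_lt_pow_right_of_lt_one₀ hρ0 hρ1 (by norm_num)))
    · -- `‖v − 1‖ = ‖ϖ‖³`: `‖v⁴ − 1‖ = ‖ϖ‖¹² > ‖4‖`, so `‖1 − ζ‖ = ‖ϖ‖¹² < ‖2‖`, `ζ = 1`, absurd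
      have hv12 : ‖v ^ 4 - 1‖ = ‖(ϖ : K)‖ ^ 12 :=
        norm_pow_four_sub_one_eq_of_eight hϖ he (t := 3) (by norm_num) le_rfl heq3
      have hbig : ‖1 - ζ * v ^ 4‖ < ‖ζ * (v ^ 4 - 1)‖ := by
        rw [norm_mul, hζ1, one_mul, hv12, h4, ← hρ16]
        exact pow_lt_pow_right_of_lt_one₀ hρ0 hρ1 (by norm_num)
      have hζn : ‖1 - ζ‖ = ‖(ϖ : K)‖ ^ 12 := by
        rw [hdecomp, IsUltrametricDist.norm_add_eq_max_of_norm_ne_norm (ne_of_lt hbig),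
          max_eq_right hbig.le, norm_mul, hζ1, one_mul, hv12]
      have hζ' : ζ = 1 := torsion_eq_one_of_norm_one_sub_lt hζ (by
        rw [hζn, ← hρ8]; exact pow_lt_pow_right_of_lt_one₀ hρ0 hρ1 (by norm_num))
      rw [hζ', sub_self, norm_zero] at hζn
      exact absurd hζn.symm (pow_pos hρ0 12).ne'
  · -- `‖v − 1‖ = ‖ϖ‖²`: `‖v⁴ − 1‖ = ‖ϖ‖⁸ = ‖2‖`, so `ζ = −1`, then Artin–Schreier
    have hv8 : ‖v ^ 4 - 1‖ = ‖(ϖ : K)‖ ^ 8 :=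
      norm_pow_four_sub_one_eq_of_eight hϖ he (t := 2) (by norm_num) (by norm_num) heq2
    have hbig : ‖1 - ζ * v ^ 4‖ < ‖ζ * (v ^ 4 - 1)‖ := by
      rw [norm_mul, hζ1, one_mul, hv8, h4, hρ8]; norm_num
    have hζn : ‖1 - ζ‖ = 2⁻¹ := by
      rw [hdecomp, IsUltrametricDist.norm_add_eq_max_of_norm_ne_norm (ne_of_lt hbig),
        max_eq_right hbig.le, norm_mul, hζ1, one_mul, hv8, hρ8]
    have hζ' : ζ = -1 := torsion_eq_neg_one_of_norm_one_sub_eq hprinc hζ hζn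
    rw [hζ'] at h4
    set z : K := v - 1 with hz
    have hzlt : ‖z‖ < 1 := by rw [heq2]; exact pow_lt_one₀ hρ0.le hρ1 (by norm_num)
    have hid : 1 - (-1) * v ^ 4 = ((z ^ 2 + 3) ^ 2 - 7) + 4 * z * (1 + z ^ 2) := by rw [hz]; ring
    have h4n : ‖(4 : K)‖ = 4⁻¹ := UnramifiedDyadic.norm_four
    have htail : ‖4 * z * (1 + z ^ 2)‖ < 4⁻¹ := by
      rw [norm_mul, norm_mul, h4n]
      have h1z : ‖1 + z ^ 2‖ ≤ 1 :=
        ult_add_le (by rw [norm_one]) (by rw [norm_pow]; exact pow_le_one₀ (norm_nonneg _) hzlt.le)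
      calc (4⁻¹ : ℝ) * ‖z‖ * ‖1 + z ^ 2‖ ≤ 4⁻¹ * ‖z‖ * 1 := by gcongr
        _ < 4⁻¹ * 1 * 1 := by gcongr
        _ = 4⁻¹ := by ring
    have hy : ‖(z ^ 2 + 3) ^ 2 - 7‖ = 4⁻¹ := by
      have hsub : (z ^ 2 + 3) ^ 2 - 7 = (1 - (-1) * v ^ 4) + -(4 * z * (1 + z ^ 2)) := by rw [hid]; ring
      have hne : ‖1 - (-1) * v ^ 4‖ ≠ ‖-(4 * z * (1 + z ^ 2))‖ := by
        rw [h4, norm_neg]; exact (ne_of_lt htail).symm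
      rw [hsub, IsUltrametricDist.norm_add_eq_max_of_norm_ne_norm hne, h4, norm_neg, max_eq_left htail.le]
    set y : K := z ^ 2 + 3 with hydef
    set d : K := y ^ 2 - 7 with hd
    have h40 : (4 : K) ≠ 0 := norm_pos_iff.mp (by rw [h4n]; norm_num)
    have hd4 : ‖d / 4‖ = 1 := by rw [norm_div, hy, h4n, div_self (by norm_num : (4⁻¹ : ℝ) ≠ 0)]
    have hηP : ‖1 - (2 + d / 4)‖ < 1 := by
      rw [show (1 : K) - (2 + d / 4) = (1 - d / 4) + -2 by ring]
      refine (IsUltrametricDist.norm_add_le_max _ _).trans_lt (max_lt (hprinc _ hd4) ?_)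
      rw [norm_neg, WildDyadic.norm_two]; norm_num
    have hsq : (i * y) ^ 2 = 1 - 4 * (2 + d / 4) := by
      rw [mul_pow, hi, hd]
      field_simp
      ring
    exact sq_ne_one_sub_four_mul hprinc hηP (i * y) hsq

/-- **Main lemma at `(8, 1)` with `ζ₁₆`.**  `e(K/ℚ₂) = 8`, units principal, `ξ⁸ = −1` in `K` ⇒ for every
root of unity `ζ` and unit `w`: `‖1 − ζ·w⁴‖ ≠ 1/4` (twist `w` by `ξ` to reach `w ≡ 1 (mod 𝔪²)`).
[cite: Koblitz1984, Ch. IV §2] -/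
theorem norm_one_sub_torsion_mul_pow_four_ne_of_pow_eight_eq_neg_one (he : absRamificationIdx 2 K = 8)
    (hprinc : ∀ u : K, ‖u‖ = 1 → IsPrincipal u) {ξ : K} (hξ : ξ ^ 8 = -1) {ζ w : K}
    (hζ : IsTorsionUnit K ζ) (hw : ‖w‖ = 1) : ‖1 - ζ * w ^ 4‖ ≠ (4 : ℝ)⁻¹ := by
  classical
  obtain ⟨ϖ, hϖ⟩ := exists_isUniformizer (F := K)
  have hρ0 : 0 < ‖(ϖ : K)‖ := norm_units_pos ϖ
  have hi : (ξ ^ 4) ^ 2 = -1 := by rw [← pow_mul]; exact hξ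
  have hξtors : IsTorsionUnit K ξ := ⟨16, by norm_num, by
    rw [show (16 : ℕ) = 8 * 2 by rfl, pow_mul, hξ]; norm_num⟩
  have hξ1 : ‖ξ‖ = 1 := hξtors.norm_eq_one
  have hξ0 : ξ ≠ 0 := norm_pos_iff.mp (by rw [hξ1]; exact one_pos)
  have hξlev : ‖1 - ξ‖ = ‖(ϖ : K)‖ := norm_one_sub_eq_unif_of_pow_eight_eq_neg_one hϖ he hξ
  have hw1 : ‖w - 1‖ ≤ ‖(ϖ : K)‖ := by
    have := norm_le_zpow_succ_of_norm_lt_zpow hϖ (k := 0) (z := w - 1)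
      (by rw [zpow_zero, norm_sub_rev]; exact hprinc w hw)
    rwa [zero_add, zpow_one] at this
  rcases hw1.lt_or_eq with hlt | heq
  · -- already `w ≡ 1 (mod 𝔪²)`
    have hw2 : ‖w - 1‖ ≤ ‖(ϖ : K)‖ ^ 2 := by
      have := norm_le_zpow_succ_of_norm_lt_zpow hϖ (k := 1) (z := w - 1) (by rw [zpow_one]; exact hlt)
      exact_mod_cast this
    exact norm_one_sub_torsion_mul_pow_four_ne_of_eight hϖ he hprinc hi hζ hw2
  · -- `w ≡ ξ (mod 𝔪²)`: twist
    set v : K := w * ξ⁻¹ with hvdef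
    have hc1 : ‖(1 - w) / (1 - ξ)‖ = 1 := by
      rw [norm_div, norm_sub_rev, heq, hξlev, div_self hρ0.ne']
    have hcP : ‖1 - (1 - w) / (1 - ξ)‖ < 1 := hprinc _ hc1
    have h1ξ0 : (1 - ξ) ≠ 0 := norm_pos_iff.mp (by rw [hξlev]; exact hρ0)
    have hvlt : ‖v - 1‖ < ‖(ϖ : K)‖ := by
      have hveq : 1 - v = (1 - ξ) * (((1 - w) / (1 - ξ) - 1) * ξ⁻¹) := by
        rw [hvdef]; field_simp; ring
      rw [norm_sub_rev, hveq, norm_mul, norm_mul, norm_inv, hξ1, inv_one, mul_one, hξlev, norm_sub_rev]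
      calc ‖(ϖ : K)‖ * ‖1 - (1 - w) / (1 - ξ)‖ < ‖(ϖ : K)‖ * 1 := by gcongr
        _ = ‖(ϖ : K)‖ := mul_one _
    have hv2 : ‖v - 1‖ ≤ ‖(ϖ : K)‖ ^ 2 := by
      have := norm_le_zpow_succ_of_norm_lt_zpow hϖ (k := 1) (z := v - 1) (by rw [zpow_one]; exact hvlt)
      exact_mod_cast this
    have hξ4 : IsTorsionUnit K (ξ ^ 4) := ⟨4, by norm_num, by
      rw [← pow_mul, show 4 * 4 = 16 by rfl, show (16 : ℕ) = 8 * 2 by rfl, pow_mul, hξ]; norm_num⟩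
    have hζ' : IsTorsionUnit K (ζ * ξ ^ 4) := IsTorsionUnit.mul (K := K) hζ hξ4
    have hrw : ζ * w ^ 4 = (ζ * ξ ^ 4) * v ^ 4 := by
      rw [hvdef]; field_simp
    rw [hrw]
    exact norm_one_sub_torsion_mul_pow_four_ne_of_eight hϖ he hprinc hi hζ' hv2

/-- **`e(K/ℚ₂) = 8`, `f(K/ℚ₂) = 1`, `ξ⁸ = −1` in `K` ⇒ `log₂(𝒪_K^×)` MISSES the unit sphere** (torsion–power
criterion). Example: `ℚ₂(ζ₁₆)`. [cite: Koblitz1984, Ch. IV §2] -/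
theorem logUnits_inter_sphere_eq_empty_of_eight_of_pow_eight_eq_neg_one (he : absRamificationIdx 2 K = 8)
    (hf : residueDegree 2 K = 1) {ξ : K} (hξ : ξ ^ 8 = -1) : logUnits K ∩ sphere 0 1 = ∅ :=
  TorsionPowerCriterion.Dyadic.logUnits_inter_sphere_eq_empty_of_forall fun _ _ hζ hw ↦
    norm_one_sub_torsion_mul_pow_four_ne_of_pow_eight_eq_neg_one he
      (fun _ hu ↦ WildDyadic.isPrincipal_of_residueDegree_eq_one hf hu) hξ hζ hw

/-! ### §4. `ℚ₂(ζ₁₆) ⊆ ℚ̄₂` and the `(8, 1)`-pair with `√−1` -/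

section AlgCl

open Polynomial IntermediateField

/-- **`ℚ₂(ζ₁₆) ⊆ ℚ̄₂`** (`ξ⁸ = −1`): degree `≤ 8`, `‖(ξ − 1)⁸‖ = ‖2‖` so `(e, f) = (8, 1)`; `(ξ⁴)² = −1`; and
`log₂(𝒪^×) ∩ 𝒪^× = ∅`. [cite: Koblitz1984, Ch. IV §2] -/
theorem exists_cyclotomic_octic_logUnits_inter_sphere_eq_empty :
    ∃ (E : IntermediateField ℚ_[2] (PadicAlgCl 2)) (_ : FiniteDimensional ℚ_[2] E),
      absRamificationIdx 2 E = 8 ∧ residueDegree 2 E = 1 ∧ (∃ i : E, i ^ 2 = -1) ∧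
        logUnits E ∩ sphere 0 1 = ∅ := by
  obtain ⟨β, hβ⟩ := IsAlgClosed.exists_pow_nat_eq (-1 : PadicAlgCl 2) (by norm_num : 0 < 8)
  have heval : Polynomial.aeval β (X ^ 8 + C (1 : ℚ_[2])) = 0 := by
    simp [hβ]
  have hint : IsIntegral ℚ_[2] β := ⟨X ^ 8 + C 1, monic_X_pow_add_C 1 (by norm_num), by
    simpa [Polynomial.aeval_def] using heval⟩
  haveI hfd : FiniteDimensional ℚ_[2] ℚ_[2]⟮β⟯ := adjoin.finiteDimensional hint
  have hξ : (⟨β, mem_adjoin_simple_self ℚ_[2] β⟩ : ℚ_[2]⟮β⟯) ^ 8 = -1 := by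
    apply Subtype.ext
    have hm1E : ((-1 : ℚ_[2]⟮β⟯) : PadicAlgCl 2) = -1 := by
      rw [show (-1 : ℚ_[2]⟮β⟯) = -(1 : ℚ_[2]⟮β⟯) by rfl]
      simp
    simp [hβ, hm1E]
  set ξ : ℚ_[2]⟮β⟯ := ⟨β, mem_adjoin_simple_self ℚ_[2] β⟩ with hξdef
  have hdeg : Module.finrank ℚ_[2] ℚ_[2]⟮β⟯ ≤ 8 := by
    rw [adjoin.finrank hint]
    have hdvd : minpoly ℚ_[2] β ∣ X ^ 8 + C 1 := minpoly.dvd ℚ_[2] β heval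
    have hne : (X ^ 8 + C (1 : ℚ_[2])) ≠ 0 := (monic_X_pow_add_C 1 (by norm_num)).ne_zero
    calc (minpoly ℚ_[2] β).natDegree ≤ (X ^ 8 + C (1 : ℚ_[2])).natDegree := natDegree_le_of_dvd hdvd hne
      _ = 8 := natDegree_X_pow_add_C
  have hnorm : ‖ξ - 1‖ ^ 8 = 2⁻¹ := by
    rw [← norm_pow]; exact norm_pow_eight_sub_one_of_pow_eight_eq_neg_one hξ
  obtain ⟨he, hf⟩ := absRamificationIdx_eq_of_norm_pow ℚ_[2]⟮β⟯ (by norm_num) hdeg hnorm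
  have hi : (ξ ^ 4) ^ 2 = -1 := by rw [← pow_mul]; exact hξ
  exact ⟨ℚ_[2]⟮β⟯, hfd, he, hf, ⟨ξ ^ 4, hi⟩,
    logUnits_inter_sphere_eq_empty_of_eight_of_pow_eight_eq_neg_one he hf hξ⟩

/-- **At `(e, f) = (8, 1)` the census bit is NOT a function of `(e, f)` even among fields containing `√−1`:**
`ℚ₂(ζ₁₆)` (empty) and `ℚ₂(⁸√−25)` (inhabited, `UnitLogWildDyadicOcticGaussian`) are both `(8, 1)` and both
contain `√−1`. (At `(4, 1)` with `√−1` it IS decided: empty, `UnitLogWildDyadicQuarticGaussian`.)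
[cite: Koblitz1984, Ch. IV §2] -/
theorem exists_octic_gaussian_pair :
    (∃ (E : IntermediateField ℚ_[2] (PadicAlgCl 2)) (_ : FiniteDimensional ℚ_[2] E),
      absRamificationIdx 2 E = 8 ∧ residueDegree 2 E = 1 ∧ (∃ i : E, i ^ 2 = -1) ∧
        logUnits E ∩ sphere 0 1 = ∅) ∧
    (∃ (E : IntermediateField ℚ_[2] (PadicAlgCl 2)) (_ : FiniteDimensional ℚ_[2] E),
      absRamificationIdx 2 E = 8 ∧ residueDegree 2 E = 1 ∧ (∃ i : E, i ^ 2 = -1) ∧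
        (logUnits E ∩ sphere 0 1).Nonempty) :=
  ⟨exists_cyclotomic_octic_logUnits_inter_sphere_eq_empty, exists_octic_gaussian_logUnits_inter_sphere_nonempty⟩

end AlgCl

end WildDyadicQuartic

end Literature.IUT.LogVolume

end
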